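import Mathlib
import Summits.Ventures.PercRepro2.RootCutTheorem
import Summits.Ventures.PercRepro2.CutRootsStates

/-!
# Both roots behind an unmarked cut vertex, II: the class, the factorisation and the theorem
(blind cell PercRepro2, p3 g3, 2026-08-25; `proofs/P3-BRIDGE.md` §11)

CLASS (`CutRoots`): an unmarked vertex `c` is a cut vertex of the support graph `z ∪ F` separating
the root side `VH ∋ a₁, a₂` from the side `VL ∋ o, b, a₃` (every open edge within one side, the
sides meet only in `c`, no typed edge within both).  On the support every copy has the state
`cutRootsSt` (`st_eq_cutRootsSt`, through the closure lemmas `conn_side` / `conn_cross` of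
`RootCutSupport.lean`), so `K₃` is the five-monomial expansion of `CutRootsStates.lean`
(`K3_eq_cutRoots`), each monomial a far-side kernel of the far-side restriction times a root-side
kernel of the root-side restriction.  Factorising (`typedCount_mul_three`) and using the copy
symmetry of the far-side counts (`typedCount_swap13`, `typedCount_swap23`):
`typedCount F z τ K₃ = (cHa − cHb) · cL · (inert count)` (`typedCount_eq_cutRoots`) with
`cL = #{b ∈ C(c) in the second copy, o ∈ C(c) ∌ a₃ in the third}` and `cHa − cHb` the root-side
count of the pointwise-nonnegative `P P P (|e_y||e_w| − e_y e_w)` — so **row 2′TRI holds on the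
class with no inequality at all** (`typedCount_nonneg_of_cutRoots`; `HasCutRoots` and
`typedCount_nonneg_of_hasCutRoots` for the residual domain).  The weighted shadow is the product
formula `Gc = 4·P_A(a₁ ↮ a₂)·P_A(a₁ ↔ c, a₂ ↮ c)·P_A(a₂ ↔ c, a₁ ↮ c)·P_B(b ↔ c)·P_B(o ↔ c, a₃ ↮ c)`
(proofs/MINE2-CUTVERTEX.md §13.2 T1, mine-2 g11).  Own work; standard axioms.
-/

namespace Summit.Ventures.PercRepro2

open UnionCluster

namespace CovForm

namespace RootBridge

open OneTyped TypedA3 Untouched TypedFactor Separated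

/-! ## The class and the states of the support -/

section Support

open Classical

variable {V : Type*} {E : Type*} [Fintype E] [DecidableEq E]
variable (ends : E → Sym2 V) (o a₁ a₂ a₃ b c : V)

/-- **Both roots behind an unmarked cut vertex `c`**: the support graph `z ∪ F` splits into a root
side `VH ∋ a₁, a₂` and a side `VL ∋ o, b, a₃` meeting only in `c`, no typed edge inside both sides,
`c` none of the five marks. -/
structure CutRoots (VL VH : Set V) (F : Finset E) (z : Config E) : Prop where
  split : ∀ e, zF F z e = true → e ∈ within ends VL ∨ e ∈ within ends VH
  cap : ∀ t, t ∈ VL → t ∈ VH → t = c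
  noloop : ∀ e ∈ F, ¬ (e ∈ within ends VL ∧ e ∈ within ends VH)
  cL : c ∈ VL
  cH : c ∈ VH
  a1H : a₁ ∈ VH
  a2H : a₂ ∈ VH
  oL : o ∈ VL
  bL : b ∈ VL
  a3L : a₃ ∈ VL
  a1c : a₁ ≠ c
  a2c : a₂ ≠ c
  oc : o ≠ c
  bc : b ≠ c
  a3c : a₃ ≠ c

omit [Fintype E] in
/-- A configuration below `z ∪ F` has its open edges within a side. -/
lemma CutRoots.split_of_le {VL VH : Set V} {F : Finset E} {z : Config E}
    (h : CutRoots ends o a₁ a₂ a₃ b c VL VH F z) {x : Config E} (hx : x ≤ zF F z) :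
    ∀ e, x e = true → e ∈ within ends VL ∨ e ∈ within ends VH := fun e he =>
  h.split e (by have := hx e; rw [he] at this; exact Bool.eq_true_of_true_le this)

/-- The far-side connection `c ↔ v` of a configuration, read inside `VL`. -/
noncomputable def gL (VL : Set V) (v : V) (x : Config E) : Bool :=
  decide (Conn ends (withinRestr ends VL x) c v)

omit [Fintype E] in
/-- **The state of a copy of the support** when the roots sit behind `c`. -/
theorem st_eq_cutRootsSt {VL VH : Set V} {F : Finset E} {z : Config E}
    (h : CutRoots ends o a₁ a₂ a₃ b c VL VH F z) {x : Config E} (hx : ∀ e, e ∉ F → x e = z e) :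
    st ends o a₁ a₂ a₃ b x =
      cutRootsSt (hstC ends a₁ c a₂ VH x) (gL ends c VL o x) (gL ends c VL b x)
        (gL ends c VL a₃ x) := by
  have hsp := CutRoots.split_of_le ends o a₁ a₂ a₃ b c h (le_zF hx)
  have hsp' : ∀ e, x e = true → e ∈ within ends VH ∨ e ∈ within ends VL := fun e he =>
    (hsp e he).symm
  have hcap' : ∀ t, t ∈ VH → t ∈ VL → t = c := fun t h1 h2 => h.cap t h2 h1
  obtain ⟨hhv, hh3, hv3⟩ := hstC_coords ends a₁ c a₂ VH x
  unfold st cutRootsSt gL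
  rw [hhv, hh3, hv3]
  have e1 : Conn ends x a₂ a₁ ↔ Conn ends (withinRestr ends VH x) a₁ a₂ := by
    rw [conn_side ends hsp' hcap' h.a2H h.a1H]
    exact ⟨conn_symm, conn_symm⟩
  have e2 : Conn ends x a₁ o ↔
      Conn ends (withinRestr ends VH x) c a₁ ∧ Conn ends (withinRestr ends VL x) c o := by
    rw [conn_cross ends hsp' hcap' ⟨h.cH, h.cL⟩ h.a1H h.oL h.oc]
    exact and_congr ⟨conn_symm, conn_symm⟩ Iff.rfl
  have e3 : Conn ends x a₂ o ↔
      Conn ends (withinRestr ends VH x) c a₂ ∧ Conn ends (withinRestr ends VL x) c o := by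
    rw [conn_cross ends hsp' hcap' ⟨h.cH, h.cL⟩ h.a2H h.oL h.oc]
    exact and_congr ⟨conn_symm, conn_symm⟩ Iff.rfl
  have e4 : Conn ends x a₁ b ↔
      Conn ends (withinRestr ends VH x) c a₁ ∧ Conn ends (withinRestr ends VL x) c b := by
    rw [conn_cross ends hsp' hcap' ⟨h.cH, h.cL⟩ h.a1H h.bL h.bc]
    exact and_congr ⟨conn_symm, conn_symm⟩ Iff.rfl
  have e5 : Conn ends x a₂ b ↔
      Conn ends (withinRestr ends VH x) c a₂ ∧ Conn ends (withinRestr ends VL x) c b := by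
    rw [conn_cross ends hsp' hcap' ⟨h.cH, h.cL⟩ h.a2H h.bL h.bc]
    exact and_congr ⟨conn_symm, conn_symm⟩ Iff.rfl
  have e6 : Conn ends x a₁ a₃ ↔
      Conn ends (withinRestr ends VH x) c a₁ ∧ Conn ends (withinRestr ends VL x) c a₃ := by
    rw [conn_cross ends hsp' hcap' ⟨h.cH, h.cL⟩ h.a1H h.a3L h.a3c]
    exact and_congr ⟨conn_symm, conn_symm⟩ Iff.rfl
  have e7 : Conn ends x a₂ a₃ ↔
      Conn ends (withinRestr ends VH x) c a₂ ∧ Conn ends (withinRestr ends VL x) c a₃ := by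
    rw [conn_cross ends hsp' hcap' ⟨h.cH, h.cL⟩ h.a2H h.a3L h.a3c]
    exact and_congr ⟨conn_symm, conn_symm⟩ Iff.rfl
  rw [decide_eq_decide.mpr e1, decide_eq_decide.mpr e2, decide_eq_decide.mpr e3,
    decide_eq_decide.mpr e4, decide_eq_decide.mpr e5, decide_eq_decide.mpr e6,
    decide_eq_decide.mpr e7]
  · simp only [Bool.decide_and]
  all_goals infer_instance

end Support

/-! ## The kernels of the two sides, the factorisation and the theorem -/

section Main

open Classical

variable {V : Type*} {E : Type*} [Fintype E] [DecidableEq E] {R : Type*} [Field R]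
  [LinearOrder R] [IsStrictOrderedRing R]
variable (ends : E → Sym2 V) (o a₁ a₂ a₃ b c : V)

/-- A root-side coefficient read on the root side. -/
noncomputable def hKR (VH : Set V) (H : HState → HState → HState → ℤ) :
    Config E → Config E → Config E → R :=
  fun x y w => ((H (hstC ends a₁ c a₂ VH x) (hstC ends a₁ c a₂ VH y) (hstC ends a₁ c a₂ VH w) : ℤ) : R)

/-- The far-side kernel `lA(y) lC(w)`. -/
noncomputable def lKAC (VL : Set V) : Config E → Config E → Config E → R :=
  fun _ y w => ((lA (gL ends c VL o y) (gL ends c VL b y) (gL ends c VL a₃ y) *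
    lC (gL ends c VL o w) (gL ends c VL b w) (gL ends c VL a₃ w) : ℤ) : R)

/-- The far-side kernel `lB'(y) lA(w)`. -/
noncomputable def lKB'A (VL : Set V) : Config E → Config E → Config E → R :=
  fun _ y w => ((lB' (gL ends c VL o y) (gL ends c VL b y) (gL ends c VL a₃ y) *
    lA (gL ends c VL o w) (gL ends c VL b w) (gL ends c VL a₃ w) : ℤ) : R)

/-- The far-side kernel `lB(y) lA(w)`: `b ∈ C(c)` in the second copy, `o ∈ C(c) ∌ a₃` in the
third. -/
noncomputable def lKBA (VL : Set V) : Config E → Config E → Config E → R :=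
  fun _ y w => ((lB (gL ends c VL o y) (gL ends c VL b y) (gL ends c VL a₃ y) *
    lA (gL ends c VL o w) (gL ends c VL b w) (gL ends c VL a₃ w) : ℤ) : R)

/-- The far-side kernel `l3(x) lB(y) lA(w)`. -/
noncomputable def lKG (VL : Set V) : Config E → Config E → Config E → R :=
  fun x y w => ((l3 (gL ends c VL o x) (gL ends c VL b x) (gL ends c VL a₃ x) *
    lB (gL ends c VL o y) (gL ends c VL b y) (gL ends c VL a₃ y) *
    lA (gL ends c VL o w) (gL ends c VL b w) (gL ends c VL a₃ w) : ℤ) : R)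

/-- The far-side kernel `lA(x) lB(y) l3(w)`. -/
noncomputable def lKG' (VL : Set V) : Config E → Config E → Config E → R :=
  fun x y w => ((lA (gL ends c VL o x) (gL ends c VL b x) (gL ends c VL a₃ x) *
    lB (gL ends c VL o y) (gL ends c VL b y) (gL ends c VL a₃ y) *
    l3 (gL ends c VL o w) (gL ends c VL b w) (gL ends c VL a₃ w) : ℤ) : R)

omit [Fintype E] [LinearOrder R] [IsStrictOrderedRing R] in
/-- The far-side bits only see the far-side typed edges. -/
lemma gL_restr (VL : Set V) (v : V) {F : Finset E} {z x : Config E}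
    (hx : ∀ e, e ∉ F → x e = z e) :
    gL ends c VL v (restr (sideF ends VL F) z x) = gL ends c VL v x := by
  unfold gL
  rw [withinRestr_restr_eq ends VL hx]

omit [Fintype E] [LinearOrder R] [IsStrictOrderedRing R] in
/-- **`K₃` on the support** when the roots sit behind `c`: the five-monomial expansion, each
monomial a far-side kernel of the far-side restriction times a root-side kernel of the root-side
restriction. -/
theorem K3_eq_cutRoots {VL VH : Set V} {F : Finset E} {z : Config E}
    (h : CutRoots ends o a₁ a₂ a₃ b c VL VH F z) {x y w : Config E}
    (hx : ∀ e, e ∉ F → x e = z e) (hy : ∀ e, e ∉ F → y e = z e) (hw : ∀ e, e ∉ F → w e = z e) :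
    (K3 ends o a₁ a₂ a₃ b x y w : R) =
      lKAC ends o a₃ b c VL (restr (sideF ends VL F) z x) (restr (sideF ends VL F) z y)
          (restr (sideF ends VL F) z w) *
        hKR ends a₁ a₂ c VH rKa (restr (sideF ends VH F) z x) (restr (sideF ends VH F) z y)
          (restr (sideF ends VH F) z w) +
      lKB'A ends o a₃ b c VL (restr (sideF ends VL F) z x) (restr (sideF ends VL F) z y)
          (restr (sideF ends VL F) z w) *
        hKR ends a₁ a₂ c VH rKa (restr (sideF ends VH F) z x) (restr (sideF ends VH F) z y)
          (restr (sideF ends VH F) z w) +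
      lKBA ends o a₃ b c VL (restr (sideF ends VL F) z x) (restr (sideF ends VL F) z y)
          (restr (sideF ends VL F) z w) *
        (-hKR ends a₁ a₂ c VH rKb (restr (sideF ends VH F) z x) (restr (sideF ends VH F) z y)
          (restr (sideF ends VH F) z w)) +
      lKG ends o a₃ b c VL (restr (sideF ends VL F) z x) (restr (sideF ends VL F) z y)
          (restr (sideF ends VL F) z w) *
        hKR ends a₁ a₂ c VH rKc (restr (sideF ends VH F) z x) (restr (sideF ends VH F) z y)
          (restr (sideF ends VH F) z w) +
      lKG' ends o a₃ b c VL (restr (sideF ends VL F) z x) (restr (sideF ends VL F) z y)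
          (restr (sideF ends VL F) z w) *
        (-hKR ends a₁ a₂ c VH rKc (restr (sideF ends VH F) z x) (restr (sideF ends VH F) z y)
          (restr (sideF ends VH F) z w)) := by
  rw [K3_eq_KB, st_eq_cutRootsSt ends o a₁ a₂ a₃ b c h hx, st_eq_cutRootsSt ends o a₁ a₂ a₃ b c h hy,
    st_eq_cutRootsSt ends o a₁ a₂ a₃ b c h hw, KB_cutRootsSt]
  unfold cutRootsExp hKR lKAC lKB'A lKBA lKG lKG'
  rw [hstC_restr ends a₁ c a₂ VH hx, hstC_restr ends a₁ c a₂ VH hy, hstC_restr ends a₁ c a₂ VH hw]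
  simp only [gL_restr ends c VL o hx, gL_restr ends c VL b hx, gL_restr ends c VL a₃ hx,
    gL_restr ends c VL o hy, gL_restr ends c VL b hy, gL_restr ends c VL a₃ hy,
    gL_restr ends c VL o hw, gL_restr ends c VL b hw, gL_restr ends c VL a₃ hw]
  push_cast
  ring

omit [Fintype E] [LinearOrder R] [IsStrictOrderedRing R] in
/-- `lC + lB' = lB` on far-side bits. -/
lemma lC_add_lB' (go gb g3 : Bool) : lC go gb g3 + lB' go gb g3 = lB go gb g3 := by
  cases go <;> cases gb <;> cases g3 <;> decide

omit [LinearOrder R] [IsStrictOrderedRing R] in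
/-- The two cancelling far-side counts agree (`typedCount_swap13`). -/
lemma count_lKG_eq (VL : Set V) (A : Finset E) (z : Config E) (τ : E → ℕ)
    (hτ : ∀ e ∈ A, τ e = 1 ∨ τ e = 2) :
    typedCount A z τ (lKG ends o a₃ b c VL : Config E → Config E → Config E → R) =
      typedCount A z τ (lKG' ends o a₃ b c VL) := by
  rw [← typedCount_swap13 A z τ hτ (lKG' ends o a₃ b c VL)]
  refine typedCount_congr' _ _ _ _ _ fun x y w => ?_
  unfold lKG lKG'
  push_cast
  ring

omit [LinearOrder R] [IsStrictOrderedRing R] in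
/-- The two same-sign far-side counts add up to `cL` (`typedCount_swap23`, `lC + lB' = lB`). -/
lemma count_lKAC_add (VL : Set V) (A : Finset E) (z : Config E) (τ : E → ℕ)
    (hτ : ∀ e ∈ A, τ e = 1 ∨ τ e = 2) :
    typedCount A z τ (lKAC ends o a₃ b c VL : Config E → Config E → Config E → R) +
      typedCount A z τ (lKB'A ends o a₃ b c VL) =
      typedCount A z τ (lKBA ends o a₃ b c VL) := by
  rw [← typedCount_swap23 A z τ hτ (lKB'A ends o a₃ b c VL),
    ← typedCount_swap23 A z τ hτ (lKBA ends o a₃ b c VL), ← typedCount_add']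
  refine typedCount_congr' _ _ _ _ _ fun x y w => ?_
  unfold lKAC lKB'A lKBA
  have e := lC_add_lB' (gL ends c VL o w) (gL ends c VL b w) (gL ends c VL a₃ w)
  have e' := congrArg (fun n : ℤ => (n : R)) e
  push_cast at e' ⊢
  linear_combination (((lA (gL ends c VL o y) (gL ends c VL b y) (gL ends c VL a₃ y) : ℤ) : R)) * e'

/-- The root-side count `cHa − cHb` is nonnegative (`rKa_sub_rKb_nonneg`). -/
theorem count_hK_sub_nonneg (VH : Set V) (B : Finset E) (z : Config E) (τ : E → ℕ) :
    0 ≤ typedCount B z τ (hKR ends a₁ a₂ c VH rKa : Config E → Config E → Config E → R) -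
      typedCount B z τ (hKR ends a₁ a₂ c VH rKb) := by
  rw [sub_eq_add_neg, ← typedCount_neg', ← typedCount_add']
  refine typedCount_nonneg_of_nonneg _ _ _ fun x y w => ?_
  unfold hKR
  have h0 := rKa_sub_rKb_nonneg (hstC ends a₁ c a₂ VH x) (hstC ends a₁ c a₂ VH y)
    (hstC ends a₁ c a₂ VH w)
  have h0' : (0 : R) ≤ ((rKa (hstC ends a₁ c a₂ VH x) (hstC ends a₁ c a₂ VH y) (hstC ends a₁ c a₂ VH w) -
      rKb (hstC ends a₁ c a₂ VH x) (hstC ends a₁ c a₂ VH y) (hstC ends a₁ c a₂ VH w) : ℤ) : R) := by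
    exact_mod_cast h0
  push_cast at h0'
  linarith

/-- The far-side count `cL` is nonnegative. -/
theorem count_lKBA_nonneg (VL : Set V) (A : Finset E) (z : Config E) (τ : E → ℕ) :
    0 ≤ typedCount A z τ (lKBA ends o a₃ b c VL : Config E → Config E → Config E → R) := by
  refine typedCount_nonneg_of_nonneg _ _ _ fun x y w => ?_
  unfold lKBA lB lA
  split_ifs <;> simp

/-- **The identity**: `typedCount F z τ K₃ = (cHa − cHb) · cL · (inert count)` when the roots sit
behind the unmarked cut vertex `c`. -/
theorem typedCount_eq_cutRoots {VL VH : Set V} (F : Finset E) (z : Config E) (τ : E → ℕ)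
    (hτ : ∀ e ∈ F, τ e = 1 ∨ τ e = 2) (h : CutRoots ends o a₁ a₂ a₃ b c VL VH F z) :
    typedCount F z τ (K3 ends o a₁ a₂ a₃ b : Config E → Config E → Config E → R) =
      (typedCount (sideF ends VH F) z τ
          (hKR ends a₁ a₂ c VH rKa : Config E → Config E → Config E → R) -
        typedCount (sideF ends VH F) z τ (hKR ends a₁ a₂ c VH rKb)) *
        typedCount (sideF ends VL F) z τ (lKBA ends o a₃ b c VL) *
        typedCount (F \ (sideF ends VL F ∪ sideF ends VH F)) z τ (fun _ _ _ => (1 : R)) := by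
  set A := sideF ends VL F with hA
  set B := sideF ends VH F with hB
  set C := F \ (A ∪ B) with hC
  have hAF : A ⊆ F := Finset.filter_subset _ _
  have hBF : B ⊆ F := Finset.filter_subset _ _
  have hAB : Disjoint A B := by
    rw [Finset.disjoint_left]
    intro e heA heB
    simp only [hA, hB, sideF, Finset.mem_filter] at heA heB
    exact h.noloop e heA.1 ⟨heA.2, heB.2⟩
  have hABF : A ∪ B ⊆ F := Finset.union_subset hAF hBF
  have hAC : Disjoint A C := Finset.disjoint_of_subset_left Finset.subset_union_left Finset.disjoint_sdiff
  have hBC : Disjoint B C := Finset.disjoint_of_subset_left Finset.subset_union_right Finset.disjoint_sdiff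
  have hF : A ∪ B ∪ C = F := Finset.union_sdiff_of_subset hABF
  have hτA : ∀ e ∈ A, τ e = 1 ∨ τ e = 2 := fun e he => hτ e (hAF he)
  have hker : typedCount F z τ (K3 ends o a₁ a₂ a₃ b : Config E → Config E → Config E → R) =
      typedCount F z τ (fun x y w =>
        (lKAC ends o a₃ b c VL (restr A z x) (restr A z y) (restr A z w) *
            hKR ends a₁ a₂ c VH rKa (restr B z x) (restr B z y) (restr B z w) +
          lKB'A ends o a₃ b c VL (restr A z x) (restr A z y) (restr A z w) *
            hKR ends a₁ a₂ c VH rKa (restr B z x) (restr B z y) (restr B z w) +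
          lKBA ends o a₃ b c VL (restr A z x) (restr A z y) (restr A z w) *
            (-hKR ends a₁ a₂ c VH rKb (restr B z x) (restr B z y) (restr B z w)) +
          lKG ends o a₃ b c VL (restr A z x) (restr A z y) (restr A z w) *
            hKR ends a₁ a₂ c VH rKc (restr B z x) (restr B z y) (restr B z w)) +
        lKG' ends o a₃ b c VL (restr A z x) (restr A z y) (restr A z w) *
          (-hKR ends a₁ a₂ c VH rKc (restr B z x) (restr B z y) (restr B z w))) := by
    refine typedCount_congr_on_support F z τ fun x y w hc _ => ?_
    rw [K3_eq_cutRoots ends o a₁ a₂ a₃ b c h (fun e he => (hc e he).1) (fun e he => (hc e he).2.1)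
      (fun e he => (hc e he).2.2)]
  rw [hker, typedCount_add', typedCount_add4]
  have h1 := typedCount_mul_three A B C hAB hAC hBC z τ (lKAC ends o a₃ b c VL)
    (hKR ends a₁ a₂ c VH rKa : Config E → Config E → Config E → R)
  have h2 := typedCount_mul_three A B C hAB hAC hBC z τ (lKB'A ends o a₃ b c VL)
    (hKR ends a₁ a₂ c VH rKa : Config E → Config E → Config E → R)
  have h3 := typedCount_mul_three A B C hAB hAC hBC z τ (lKBA ends o a₃ b c VL)
    (fun x y w => -(hKR ends a₁ a₂ c VH rKb x y w : R))
  have h4 := typedCount_mul_three A B C hAB hAC hBC z τ (lKG ends o a₃ b c VL)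
    (hKR ends a₁ a₂ c VH rKc : Config E → Config E → Config E → R)
  have h5 := typedCount_mul_three A B C hAB hAC hBC z τ (lKG' ends o a₃ b c VL)
    (fun x y w => -(hKR ends a₁ a₂ c VH rKc x y w : R))
  rw [hF] at h1 h2 h3 h4 h5
  rw [h1, h2, h3, h4, h5, typedCount_neg', typedCount_neg']
  have hsum := count_lKAC_add (R := R) ends o a₃ b c VL A z τ hτA
  have hG := count_lKG_eq (R := R) ends o a₃ b c VL A z τ hτA
  set cAC := typedCount A z τ (lKAC ends o a₃ b c VL : Config E → Config E → Config E → R) with hcAC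
  set cB'A := typedCount A z τ (lKB'A ends o a₃ b c VL : Config E → Config E → Config E → R) with hcB'A
  set cBA := typedCount A z τ (lKBA ends o a₃ b c VL : Config E → Config E → Config E → R) with hcBA
  set cG := typedCount A z τ (lKG ends o a₃ b c VL : Config E → Config E → Config E → R) with hcG
  set cG' := typedCount A z τ (lKG' ends o a₃ b c VL : Config E → Config E → Config E → R) with hcG'
  set Ha := typedCount B z τ (hKR ends a₁ a₂ c VH rKa : Config E → Config E → Config E → R) with hHa
  set Hb := typedCount B z τ (hKR ends a₁ a₂ c VH rKb : Config E → Config E → Config E → R) with hHb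
  set Hc := typedCount B z τ (hKR ends a₁ a₂ c VH rKc : Config E → Config E → Config E → R) with hHc
  set I := typedCount C z τ (fun _ _ _ => (1 : R)) with hI
  linear_combination (Ha * I) * hsum + (Hc * I) * hG

/-- **Row 2′TRI when an unmarked cut vertex separates the two roots from `{o, b, a₃}`**
(`P3-BRIDGE.md` §11), for every pinning and every type map with values in `{1, 2}` — with no
inequality: the typed base is a product of two counts. -/
theorem typedCount_nonneg_of_cutRoots {VL VH : Set V} (F : Finset E) (z : Config E)
    (τ : E → ℕ) (hτ : ∀ e ∈ F, τ e = 1 ∨ τ e = 2) (h : CutRoots ends o a₁ a₂ a₃ b c VL VH F z) :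
    0 ≤ typedCount F z τ (K3 ends o a₁ a₂ a₃ b : Config E → Config E → Config E → R) := by
  rw [typedCount_eq_cutRoots ends o a₁ a₂ a₃ b c F z τ hτ h]
  have hH := count_hK_sub_nonneg (R := R) ends a₁ a₂ c VH (sideF ends VH F) z τ
  have hL := count_lKBA_nonneg (R := R) ends o a₃ b c VL (sideF ends VL F) z τ
  have hI : (0 : R) ≤ typedCount (F \ (sideF ends VL F ∪ sideF ends VH F)) z τ
      (fun _ _ _ => (1 : R)) :=
    typedCount_nonneg_of_nonneg _ _ _ fun _ _ _ => zero_le_one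
  exact mul_nonneg (mul_nonneg hH hL) hI

/-- **The class of the typed graph `(V, F)`**: an unmarked vertex `c` is a cut vertex of `(V, F)`
separating `{a₁, a₂}` from `{o, b, a₃}`. -/
def HasCutRoots (F : Finset E) : Prop :=
  ∃ (c : V) (VL VH : Set V), CutRoots ends o a₁ a₂ a₃ b c VL VH F (fun _ => false)

/-- **Row 2′TRI on the class at `z ≡ false`** — a conjunct for the residual domain. -/
theorem typedCount_nonneg_of_hasCutRoots (F : Finset E) (τ : E → ℕ)
    (hτ : ∀ e ∈ F, τ e = 1 ∨ τ e = 2) (h : HasCutRoots ends o a₁ a₂ a₃ b F) :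
    0 ≤ typedCount F (fun _ => false) τ (K3 ends o a₁ a₂ a₃ b : Config E → Config E → Config E → R) := by
  obtain ⟨c, VL, VH, hc⟩ := h
  exact typedCount_nonneg_of_cutRoots ends o a₁ a₂ a₃ b c F _ τ hτ hc

end Main

end RootBridge

end CovForm

end Summit.Ventures.PercRepro2
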